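import Summits.QuantumFields.BalabanUV.Beta.MultiscaleGradientSource
import Summits.QuantumFields.BalabanUV.Beta.HarmonicGradientInterior

/-!
# `Summit.QuantumFields.BalabanUV.Beta.MultiscaleHessianIdentity` — engine file 22a: THE TORUS HESSIAN IDENTITY
# `c₀²·Σ_x Σ_{μ,ν} Σ_i ((D_μ f)(x + e_ν, i) − (D_μ f)(x, i))² = Σ_p ((D*D f)(p))²` for FLAT transport `Rm ≡ 1` and a CONSTANT bond
# weight `c ≡ c₀` on the unit torus `UT N` — the lattice form of `Σ_{μν}‖∂_μ∂_ν g‖² = ‖Δg‖²` (summation by parts twice; forward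
# differences in different directions commute) — the algebraic input of the pure second-order ℓ² members (3.46)₄,₆ of [B9] Thm 3.1 at
# MODEL level (programme «HESSIAN-L2-FLAT», files 22b–22f)

HONEST FRAMING (page 1 of everything in this cell).  Discharging `FlowStep.BetaPertH` would make Bałaban's ultraviolet
stability UNCONDITIONAL — a constructive-QFT result; it is NOT the continuum limit and NOT the Clay problem.  This module
discharges nothing of `BetaPertH`; it is [folklore] lattice calculus, kernel-checked, by the OWNER of binder row D4 (unit
`b2b-balaban-beta-an4`, gen 47).  HONEST DEPENDENCY: continuum YM on T⁴ ⇐ BetaPertH ∧ nine spine estimates (0/9 proved); BetaPertH ⇐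
(D1) ∧ (D4) ∧ CAP+tail; G-an2-4 gates asym, D1 and NE2/3/4.

THE POINT (O.2 item (i), MODEL level; NOT the critical path).  Census E-an4-141e lists the pure second-order ℓ² members
(3.46)₄ «‖h∇_U∇_UG′(U)λ‖ ≤ B₀·1·|h|e^{−δ₀d(y,y′)}‖λ‖» and (3.46)₆ «‖hG′(U)∇*_U∇*_Uλ‖ ≤ …» as OPEN at MODEL level and LOCATES the flat
route: «the torus identity Σ_{μν}‖δ_μδ_νf‖² = ‖Δf‖² (summation by parts, commuting shifts `up_up_comm`)».  THIS FILE is that identity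
for the covariant objects of the MODEL with flat transport and constant weight, where `(D_μ f)(x,i) = c₀(f(x+e_μ,i) − f(x,i))`
(`covD_flat`) and `(D*D f)(x,i) = −c₀²Σ_ν(f(x+e_ν,i) − 2f(x,i) + f(x−e_ν,i))` (`covLap_flat_component` + `nb_const` + `W_const`):
* §1 scalar torus calculus for `h : UT N → ℝ`: translation invariance of `Σ_x` under `x ↦ x ± e_μ` (`sum_up_eq`, `sum_dn_eq`),
  SUMMATION BY PARTS `Σ_x (F(x) − F(x−e_μ))·G(x) = −Σ_x F(x)·(G(x+e_μ) − G(x))` (`sum_bwd_diff_mul`), the commutation of a forward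
  difference with a centred second difference in another direction (`fwd_diff_lap_comm`, by `up_up_comm`∕`dn_up_comm`), and the PAIR
  IDENTITY `Σ_x (h(x+e_μ+e_ν) − h(x+e_ν) − h(x+e_μ) + h(x))² = Σ_x (h(x+e_μ) − 2h(x) + h(x−e_μ))·(h(x+e_ν) − 2h(x) + h(x−e_ν))`
  (`sum_mixed_sq_eq_sum_lap_mul_lap`);
* §2 **`hessian_identity`** — `c₀²·Σ_x Σ_μ Σ_ν Σ_i ((covD f)((x+e_ν, μ), i) − (covD f)((x, μ), i))² = Σ_p ((covDT (covD f))(p))²`, and its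
  corollary **`sum_cell_hessian_le`**: for every finite set of sites `P`, `c₀²·Σ_{x ∈ P} Σ_{μ,ν,i}(δ_νD_μ f)² ≤ Σ_p ((D*D f)(p))²`.
WHAT THIS IS NOT: flat transport only — for a rough∕covariant `Rm` the identity acquires curvature (holonomy) terms (Weitzenböck), which is
where (3.35) enters for Bałaban's `G′(U)` (E-an4-141d (4)–(5)); nothing of Bałaban's ∇_U∇_UG′(U) is instantiated; row D4 readiness width 0;
D4 DISCHARGE NO DATE.

WHAT IS CERTIFIED (kernel, 0 sorry, 0 def): the theorems above.  LOCATORS (shape only; ABSOLUTE RULE — nothing printed is asserted):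
[Balaban1985BackgroundPropagators] Thm 3.1 (3.46) p. 398, (3.3) pp. 390–391, (3.23) p. 394.  NOT BetaPertH, NOT continuum, NOT Clay,
NOT summit progress.
-/

open scoped BigOperators
open Finset

namespace Summit.QuantumFields.BalabanUV.Beta.MultiscaleHessianIdentity

open Summit.QuantumFields.BalabanUV.Beta.MultiscaleGradientSource (covD_flat covLap_flat_component)
open Summit.QuantumFields.BalabanUV.Beta.HarmonicGradientInterior (up_up_comm dn_up_comm nb_const)
open Summit.QuantumFields.BalabanUV.Beta.DeGiorgiStep (W_const)
open Literature.MathematicalPhysics.QuantumFieldTheory.Balaban1983to89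
open Literature.MathematicalPhysics.QuantumFieldTheory.Balaban1983to89.B9Thm37Glue (covD covDT)
open Literature.MathematicalPhysics.QuantumFieldTheory.Balaban1983to89.B9Thm37GluePU (bsrc btgt bsrc_apply btgt_apply)
open Literature.MathematicalPhysics.QuantumFieldTheory.Balaban1983to89.B9Thm37GlueTorusCovCT (up_injective)
open B5TorusCover (UT)
open B5Leibniz121 (up dn up_dn)
open B5DirichletDg (dn_up)

noncomputable section

variable {d : ℕ} {N : Fin d → ℕ} [∀ i, NeZero (N i)]

/-! ## §1 Scalar torus calculus -/

/-- Translation invariance of the torus sum under `x ↦ x + e_μ`. [folklore] -/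
theorem sum_up_eq {α : Type*} [AddCommMonoid α] (F : UT N → α) (μ : Fin d) : ∑ x, F (up x μ) = ∑ x, F x :=
  Fintype.sum_bijective (fun x : UT N => up x μ)
    (Finite.injective_iff_bijective.mp (up_injective μ)) (fun x => F (up x μ)) F fun _ => rfl

/-- `x ↦ x − e_μ` is injective on the torus. [folklore] -/
theorem dn_injective (μ : Fin d) : Function.Injective fun y : UT N => dn y μ := by
  intro x y h
  have h' := congrArg (fun z => up z μ) h
  simpa only [up_dn] using h'

/-- Translation invariance of the torus sum under `x ↦ x − e_μ`. [folklore] -/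
theorem sum_dn_eq {α : Type*} [AddCommMonoid α] (F : UT N → α) (μ : Fin d) : ∑ x, F (dn x μ) = ∑ x, F x :=
  Fintype.sum_bijective (fun x : UT N => dn x μ)
    (Finite.injective_iff_bijective.mp (dn_injective μ)) (fun x => F (dn x μ)) F fun _ => rfl

/-- **SUMMATION BY PARTS on the torus**: `Σ_x (F(x) − F(x − e_μ))·G(x) = −Σ_x F(x)·(G(x + e_μ) − G(x))`. [folklore] -/
theorem sum_bwd_diff_mul (F G : UT N → ℝ) (μ : Fin d) :
    ∑ x, (F x - F (dn x μ)) * G x = -∑ x, F x * (G (up x μ) - G x) := by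
  have h : ∑ x, F (dn x μ) * G x = ∑ x, F x * G (up x μ) := by
    rw [← sum_up_eq (fun x => F (dn x μ) * G x) μ]
    exact Finset.sum_congr rfl fun x _ => by rw [dn_up]
  simp only [sub_mul, mul_sub, Finset.sum_sub_distrib, h]
  ring

/-- A forward difference in direction `μ` commutes with the centred second difference in direction `ν`. [folklore] -/
theorem fwd_diff_lap_comm (h : UT N → ℝ) (μ ν : Fin d) (x : UT N) :
    (h (up (up x μ) ν) - 2 * h (up x μ) + h (dn (up x μ) ν)) - (h (up x ν) - 2 * h x + h (dn x ν)) =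
      (h (up (up x ν) μ) - h (up x ν)) - 2 * (h (up x μ) - h x) + (h (up (dn x ν) μ) - h (dn x ν)) := by
  rw [up_up_comm x μ ν, dn_up_comm x μ ν]
  ring

/-- **THE PAIR IDENTITY**: `Σ_x (h(x+e_μ+e_ν) − h(x+e_ν) − h(x+e_μ) + h(x))² = Σ_x (h(x+e_μ) − 2h(x) + h(x−e_μ))·(h(x+e_ν) − 2h(x) + h(x−e_ν))`
— summation by parts in `μ`, commutation, summation by parts in `ν`. [folklore] -/
theorem sum_mixed_sq_eq_sum_lap_mul_lap (h : UT N → ℝ) (μ ν : Fin d) :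
    ∑ x, (h (up (up x μ) ν) - h (up x ν) - h (up x μ) + h x) ^ 2 =
      ∑ x, (h (up x μ) - 2 * h x + h (dn x μ)) * (h (up x ν) - 2 * h x + h (dn x ν)) := by
  -- the forward difference in `μ` and the mixed difference
  set F : UT N → ℝ := fun x => h (up x μ) - h x with hF
  set K : UT N → ℝ := fun x => h (up (up x μ) ν) - h (up x ν) - h (up x μ) + h x with hK
  set G : UT N → ℝ := fun x => h (up x ν) - 2 * h x + h (dn x ν) with hG
  -- `lap_μ h = F − F(· − e_μ)`
  have hlapμ : ∀ x, h (up x μ) - 2 * h x + h (dn x μ) = F x - F (dn x μ) := fun x => by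
    simp only [hF]; rw [up_dn]; ring
  -- `F(x + e_ν) − F(x) = K(x)` (commuting shifts) and `lap_ν F = K − K(· − e_ν)`
  have hFK : ∀ x, F (up x ν) - F x = K x := fun x => by
    simp only [hF, hK]; rw [up_up_comm x ν μ]; ring
  have hGK : ∀ x, G (up x μ) - G x = K x - K (dn x ν) := fun x => by
    have e1 := fwd_diff_lap_comm h μ ν x
    have e2 : K (dn x ν) = F x - F (dn x ν) := by rw [← hFK (dn x ν), up_dn]
    have e3 := hFK x
    simp only [hG, hF, hK] at e1 e2 e3 ⊢
    linarith
  calc ∑ x, (h (up (up x μ) ν) - h (up x ν) - h (up x μ) + h x) ^ 2 = ∑ x, K x * K x := by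
        refine Finset.sum_congr rfl fun x _ => ?_; simp only [hK]; ring
    _ = ∑ x, K x * (F (up x ν) - F x) := by
        refine Finset.sum_congr rfl fun x _ => ?_; rw [hFK]
    _ = -∑ x, (K x - K (dn x ν)) * F x := by rw [sum_bwd_diff_mul K F ν]; ring
    _ = -∑ x, (G (up x μ) - G x) * F x := by
        congr 1; refine Finset.sum_congr rfl fun x _ => ?_; rw [hGK]
    _ = -∑ x, F x * (G (up x μ) - G x) := by
        congr 1; refine Finset.sum_congr rfl fun x _ => ?_; ring
    _ = ∑ x, (F x - F (dn x μ)) * G x := by rw [sum_bwd_diff_mul F G μ]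
    _ = _ := by refine Finset.sum_congr rfl fun x _ => ?_; rw [← hlapμ]

/-- `(Σ_μ a_μ)² = Σ_μ Σ_ν a_μ a_ν`. [folklore] -/
theorem sq_sum_eq_sum_sum_mul {ι : Type*} [Fintype ι] (a : ι → ℝ) : (∑ μ, a μ) ^ 2 = ∑ μ, ∑ ν, a μ * a ν := by
  rw [sq, Finset.sum_mul_sum]

/-! ## §2 The Hessian identity for the covariant objects with flat transport and constant weight -/

variable {Cp : Type} [Fintype Cp] [DecidableEq Cp]

/-- The covariant Laplacian with flat transport and constant weight is `−c₀²·Σ_ν` (centred second differences), componentwise.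
[folklore] -/
theorem covLap_flat_const {Rm : UT N × Fin d → Cp → Cp → ℝ} (hflat : ∀ b k i, Rm b k i = if k = i then 1 else 0)
    {c : UT N × Fin d → ℝ} {c₀ : ℝ} (hcc : ∀ b, c b = c₀) (f : UT N × Cp → ℝ) (x : UT N) (i : Cp) :
    covDT bsrc btgt c Rm (covD bsrc btgt c Rm f) (x, i) =
      -(c₀ ^ 2 * ∑ ν, (f (up x ν, i) - 2 * f (x, i) + f (dn x ν, i))) := by
  rw [covLap_flat_component hflat c f x i, nb_const hcc (fun y => f (y, i)) x, W_const hcc x]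
  rw [Finset.sum_add_distrib, Finset.sum_sub_distrib, Finset.sum_const, Finset.card_univ, Fintype.card_fin, nsmul_eq_mul]
  ring

/-- Reordering of a fourfold sum: `(a,b,c,d) ↦ (b,c,d,a)`. [folklore] -/
theorem sum_reorder4 {α β γ δ : Type*} [Fintype α] [Fintype β] [Fintype γ] [Fintype δ] (T : α → β → γ → δ → ℝ) :
    ∑ x, ∑ μ, ∑ ν, ∑ i, T x μ ν i = ∑ μ, ∑ ν, ∑ i, ∑ x, T x μ ν i := by
  conv_lhs => rw [Finset.sum_comm]
  refine Finset.sum_congr rfl fun μ _ => ?_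
  conv_lhs => rw [Finset.sum_comm]
  refine Finset.sum_congr rfl fun ν _ => ?_
  conv_lhs => rw [Finset.sum_comm]

/-- Reordering of a threefold sum: `(a,b,c) ↦ (b,c,a)`. [folklore] -/
theorem sum_reorder3 {α β γ : Type*} [Fintype α] [Fintype β] [Fintype γ] (T : α → β → γ → ℝ) :
    ∑ i, ∑ μ, ∑ ν, T i μ ν = ∑ μ, ∑ ν, ∑ i, T i μ ν := by
  conv_lhs => rw [Finset.sum_comm]
  refine Finset.sum_congr rfl fun μ _ => ?_
  conv_lhs => rw [Finset.sum_comm]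

/-- **THE TORUS HESSIAN IDENTITY (flat transport, constant weight).**
`c₀²·Σ_x Σ_μ Σ_ν Σ_i ((D f)((x+e_ν, μ), i) − (D f)((x, μ), i))² = Σ_p ((D*D f)(p))²`.
[cite: Balaban1985BackgroundPropagators, Thm 3.1 (3.46) p.398 + (3.3) p.391] [folklore] -/
theorem hessian_identity {Rm : UT N × Fin d → Cp → Cp → ℝ} (hflat : ∀ b k i, Rm b k i = if k = i then 1 else 0)
    {c : UT N × Fin d → ℝ} {c₀ : ℝ} (hcc : ∀ b, c b = c₀) (f : UT N × Cp → ℝ) :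
    c₀ ^ 2 * ∑ x : UT N, ∑ μ : Fin d, ∑ ν : Fin d, ∑ i : Cp,
        (covD bsrc btgt c Rm f ((up x ν, μ), i) - covD bsrc btgt c Rm f ((x, μ), i)) ^ 2 =
      ∑ p : UT N × Cp, (covDT bsrc btgt c Rm (covD bsrc btgt c Rm f) p) ^ 2 := by
  -- componentwise scalar functions
  have hD : ∀ (y : UT N) (μ : Fin d) (i : Cp), covD bsrc btgt c Rm f ((y, μ), i) = c₀ * (f (up y μ, i) - f (y, i)) := by
    intro y μ i
    rw [covD_flat hflat c f (y, μ) i, hcc, btgt_apply, bsrc_apply]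
  -- the mixed second difference and the centred second differences, per component
  set M : UT N → Fin d → Fin d → Cp → ℝ := fun x μ ν i =>
    f (up (up x μ) ν, i) - f (up x ν, i) - f (up x μ, i) + f (x, i) with hM
  set Lp : UT N → Fin d → Cp → ℝ := fun x μ i => f (up x μ, i) - 2 * f (x, i) + f (dn x μ, i) with hLp
  have hD2 : ∀ x μ ν i, (covD bsrc btgt c Rm f ((up x ν, μ), i) - covD bsrc btgt c Rm f ((x, μ), i)) ^ 2 =
      c₀ ^ 2 * M x μ ν i ^ 2 := by
    intro x μ ν i
    rw [hD, hD, up_up_comm x ν μ]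
    simp only [hM]
    ring
  -- left side: `c₀²·c₀²·Σ_μ Σ_ν Σ_i Σ_x M²`
  have hL : ∑ x : UT N, ∑ μ : Fin d, ∑ ν : Fin d, ∑ i : Cp,
        (covD bsrc btgt c Rm f ((up x ν, μ), i) - covD bsrc btgt c Rm f ((x, μ), i)) ^ 2 =
      c₀ ^ 2 * ∑ μ : Fin d, ∑ ν : Fin d, ∑ i : Cp, ∑ x : UT N, M x μ ν i ^ 2 := by
    calc ∑ x : UT N, ∑ μ : Fin d, ∑ ν : Fin d, ∑ i : Cp,
          (covD bsrc btgt c Rm f ((up x ν, μ), i) - covD bsrc btgt c Rm f ((x, μ), i)) ^ 2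
        = ∑ x : UT N, ∑ μ : Fin d, ∑ ν : Fin d, ∑ i : Cp, c₀ ^ 2 * M x μ ν i ^ 2 :=
          Finset.sum_congr rfl fun x _ => Finset.sum_congr rfl fun μ _ => Finset.sum_congr rfl fun ν _ =>
            Finset.sum_congr rfl fun i _ => hD2 x μ ν i
      _ = ∑ μ : Fin d, ∑ ν : Fin d, ∑ i : Cp, ∑ x : UT N, c₀ ^ 2 * M x μ ν i ^ 2 := sum_reorder4 _
      _ = c₀ ^ 2 * ∑ μ : Fin d, ∑ ν : Fin d, ∑ i : Cp, ∑ x : UT N, M x μ ν i ^ 2 := by simp only [← Finset.mul_sum]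
  -- right side: `c₀⁴·Σ_μ Σ_ν Σ_i Σ_x Lp_μ·Lp_ν`
  have hR : ∑ p : UT N × Cp, (covDT bsrc btgt c Rm (covD bsrc btgt c Rm f) p) ^ 2 =
      c₀ ^ 2 * (c₀ ^ 2 * ∑ μ : Fin d, ∑ ν : Fin d, ∑ i : Cp, ∑ x : UT N, Lp x μ i * Lp x ν i) := by
    have e : ∀ x i, (covDT bsrc btgt c Rm (covD bsrc btgt c Rm f) (x, i)) ^ 2 =
        ∑ μ, ∑ ν, c₀ ^ 2 * (c₀ ^ 2 * (Lp x μ i * Lp x ν i)) := by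
      intro x i
      rw [covLap_flat_const hflat hcc f x i, neg_sq, mul_pow, sq_sum_eq_sum_sum_mul, Finset.mul_sum]
      refine Finset.sum_congr rfl fun μ _ => ?_
      rw [Finset.mul_sum]
      refine Finset.sum_congr rfl fun ν _ => ?_
      simp only [hLp]
      ring
    calc ∑ p : UT N × Cp, (covDT bsrc btgt c Rm (covD bsrc btgt c Rm f) p) ^ 2
        = ∑ x : UT N, ∑ i : Cp, (covDT bsrc btgt c Rm (covD bsrc btgt c Rm f) (x, i)) ^ 2 := Fintype.sum_prod_type _
      _ = ∑ x : UT N, ∑ i : Cp, ∑ μ, ∑ ν, c₀ ^ 2 * (c₀ ^ 2 * (Lp x μ i * Lp x ν i)) :=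
          Finset.sum_congr rfl fun x _ => Finset.sum_congr rfl fun i _ => e x i
      _ = ∑ i : Cp, ∑ μ, ∑ ν, ∑ x : UT N, c₀ ^ 2 * (c₀ ^ 2 * (Lp x μ i * Lp x ν i)) := sum_reorder4 _
      _ = ∑ μ, ∑ ν, ∑ i : Cp, ∑ x : UT N, c₀ ^ 2 * (c₀ ^ 2 * (Lp x μ i * Lp x ν i)) := sum_reorder3 _
      _ = c₀ ^ 2 * (c₀ ^ 2 * ∑ μ : Fin d, ∑ ν : Fin d, ∑ i : Cp, ∑ x : UT N, Lp x μ i * Lp x ν i) := by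
          simp only [← Finset.mul_sum]
  rw [hL, hR]
  congr 1; congr 1
  refine Finset.sum_congr rfl fun μ _ => Finset.sum_congr rfl fun ν _ => Finset.sum_congr rfl fun i _ => ?_
  have h := sum_mixed_sq_eq_sum_lap_mul_lap (fun y => f (y, i)) μ ν
  simpa only [hM, hLp] using h

/-- **Corollary: the Hessian energy of any set of sites is below `‖D*D f‖²/c₀²`** —
`c₀²·Σ_{x ∈ P} Σ_{μ,ν,i} ((D f)((x+e_ν,μ),i) − (D f)((x,μ),i))² ≤ Σ_p ((D*D f)(p))²`. [folklore] -/
theorem sum_cell_hessian_le {Rm : UT N × Fin d → Cp → Cp → ℝ} (hflat : ∀ b k i, Rm b k i = if k = i then 1 else 0)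
    {c : UT N × Fin d → ℝ} {c₀ : ℝ} (hcc : ∀ b, c b = c₀) (f : UT N × Cp → ℝ) (P : Finset (UT N)) :
    c₀ ^ 2 * ∑ x ∈ P, ∑ μ : Fin d, ∑ ν : Fin d, ∑ i : Cp,
        (covD bsrc btgt c Rm f ((up x ν, μ), i) - covD bsrc btgt c Rm f ((x, μ), i)) ^ 2 ≤
      ∑ p : UT N × Cp, (covDT bsrc btgt c Rm (covD bsrc btgt c Rm f) p) ^ 2 := by
  rw [← hessian_identity hflat hcc f]
  refine mul_le_mul_of_nonneg_left ?_ (sq_nonneg _)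
  exact Finset.sum_le_sum_of_subset_of_nonneg (Finset.subset_univ P) fun x _ _ =>
    Finset.sum_nonneg fun μ _ => Finset.sum_nonneg fun ν _ => Finset.sum_nonneg fun i _ => sq_nonneg _

end

end Summit.QuantumFields.BalabanUV.Beta.MultiscaleHessianIdentity
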